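import Summits.CriticalPhenomena.PercolationContinuityZ3.Theorems.PercNearOneGluingAdditiveGluing
import Literature.Probability.Percolation.KozmaNitzanPinning
import HarnessLib

/-!
# QUANT lane (R2): the ADDITIVE gluing inequality transported to the graphs Kozma–Nitzan's §4 uses

builds on p205010 (kernel theorem, internal audit signed; external expert review pending)

Cell `prim-quant` (post-continuity programme, LANE 1), seat `prim-quant-p2` (METHOD = effective Kozma–Nitzan
reduction), memo `run/shared/lean/prim/quant/P2-EFFECTIVE-KN.md` §1/§5 (step S1).

The tree theorem `AdditiveGluing_proof` (file `…Theorems/PercNearOneGluingAdditiveGluing.lean`; the crux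
`PercNearOneGluing.AdditiveGluing`, stmt-CriticalPhenomena-4576, proved by the conditioned-slack-hierarchy programme
of the prim cell) is typed over `Fin n`:
`(∀ a ∈ A, 1 − t ≤ P(a ↔ b)) → P(⋃_{a∈A} {o ↔ a}) − t ≤ P(o ↔ b)`.
Kozma–Nitzan's Lemma 10 (KN arXiv:2401.12397 §4, Step V, pp. 21–22) consumes the gluing inequality on the
contraction graphs `K_ξ`: finitely supported weightings of a countable vertex type (`Site d`), with the TARGET a
finite SET `T` wired to a point, and with relays known to be reliable to `T` only by paths inside a region `Rg`.
This file performs the three transports for the ADDITIVE inequality, exactly parallel to the tree's transports of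
Conjecture 3 (`KozmaNitzan2024_conjecture3.fintype/.finSupp/.openConn_set`, file
`Literature/Probability/Percolation/KozmaNitzanPinning.lean`):

* `Quant.additiveGluing_fintype` — any finite vertex type (relabel along `Fintype.equivFin`);
* `Quant.additiveGluing_finSupp` — finitely supported weights on a countable vertex type (restriction coupling);
* `Quant.additiveGluing_finSupp_set` — target SET `T` and region-internal relay reliability (wiring `wireW T`).

Because the additive inequality is an inequality between the SAME three probabilities that the transports preserve
exactly, no constant is lost: the slack `t` is untouched.  These are the inputs of the additive Step V of the
effective target lemma (`…Theorems/PercNearOneGluingNoHeavyQuantEffectiveTargetLemma.lean`).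
No new definitions; no sorries; standard axioms.
-/

noncomputable section

namespace Summit.CriticalPhenomena.PercolationContinuityZ3.Theorems.Quant

open MeasureTheory Literature.Probability.LatticeModels Literature.Probability.Percolation

/-- **Additive gluing over every finite vertex type**: for a weighting `w` of the pairs of a finite type `V`,
relays `A`, observer `o`, target `b` and slack `t ≥ 0` with `P(a ↔ b) ≥ 1 − t` for all `a ∈ A`,
`P(o ↔ A) − t ≤ P(o ↔ b)`.  Proof: relabel along `Fintype.equivFin V` (restriction coupling
`prodBernoulli_map_restrictConfig` along the bijection) and apply the tree theorem `AdditiveGluing_proof`.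
builds on p205010 (kernel theorem, internal audit signed; external expert review pending).
[cite: KozmaNitzan2024, Conjecture 1 (p. 3) and Conjecture 3 (p. 15)] -/
theorem additiveGluing_fintype {V : Type*} [Fintype V] (w : Sym2 V → unitInterval) (A : Finset V) (o b : V)
    {t : ℝ} (ht : 0 ≤ t) (hab : ∀ a ∈ A, 1 - t ≤ (prodBernoulli w).real (openConn a b)) :
    (prodBernoulli w).real (⋃ a ∈ A, openConn o a) - t ≤ (prodBernoulli w).real (openConn o b) := by
  classical
  set e := Fintype.equivFin V with he
  have hf : Function.Injective (e.symm : Fin (Fintype.card V) → V) := e.symm.injective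
  set w' : Sym2 (Fin (Fintype.card V)) → unitInterval := w ∘ Sym2.map e.symm with hw'
  have hmap := prodBernoulli_map_restrictConfig w hf
  -- transport of the three probabilities
  have key : ∀ x y : V, (prodBernoulli w').real (openConn (e x) (e y)) = (prodBernoulli w).real (openConn x y) := by
    intro x y
    rw [hw', ← hmap, map_measureReal_apply (measurable_restrictConfig _) (measurableSet_openConn_holds _ _),
      restrictConfig_symm_preimage_openConn]
  have keyU : (prodBernoulli w').real (⋃ a ∈ A.map e.toEmbedding, openConn (e o) a) =
      (prodBernoulli w).real (⋃ a ∈ A, openConn o a) := by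
    rw [hw', ← hmap, map_measureReal_apply (measurable_restrictConfig _)
      (Finset.measurableSet_biUnion _ fun a _ => measurableSet_openConn_holds _ _)]
    congr 1
    exact restrictConfig_symm_preimage_biUnion_openConn e o A
  have h1 := AdditiveGluing_proof (Fintype.card V) w' (A.map e.toEmbedding) (e o) (e b) t ht (by
    intro a ha
    rw [Finset.mem_map_equiv] at ha
    have := hab (e.symm a) ha
    rwa [← key, Equiv.apply_symm_apply] at this)
  rwa [key, keyU] at h1

/-- **Additive gluing for finitely supported weights on a countable vertex type**: if `w` vanishes on every
pair not inside the finite set `S`, then for `A ⊆ S`, `o, b ∈ S`, `t ≥ 0` and `P(a ↔ b) ≥ 1 − t` (`a ∈ A`),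
`P(o ↔ A) − t ≤ P(o ↔ b)`.  Proof: the restriction coupling to the finite graph on `S`, on which the
configuration a.s. lives (as in `KozmaNitzan2024_conjecture3.finSupp`), then `additiveGluing_fintype`.
builds on p205010 (kernel theorem, internal audit signed; external expert review pending).
[cite: KozmaNitzan2024, Conjecture 1 (p. 3) and Conjecture 3 (p. 15)] -/
theorem additiveGluing_finSupp {V : Type*} [Countable V] (w : Sym2 V → unitInterval) (S : Finset V)
    (hw : ∀ e : Sym2 V, (∃ x ∈ e, x ∉ S) → w e = 0) (A : Finset V) (o b : V)
    (hAS : A ⊆ S) (ho : o ∈ S) (hb : b ∈ S) {t : ℝ} (ht : 0 ≤ t)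
    (hab : ∀ a ∈ A, 1 - t ≤ (prodBernoulli w).real (openConn a b)) :
    (prodBernoulli w).real (⋃ a ∈ A, openConn o a) - t ≤ (prodBernoulli w).real (openConn o b) := by
  classical
  set Sset : Set V := ↑S with hSset
  set f : Sset → V := Subtype.val with hf
  have hfi : Function.Injective f := Subtype.val_injective
  set w' : Sym2 Sset → unitInterval := w ∘ Sym2.map f with hw'
  have hmap := prodBernoulli_map_restrictConfig w hfi
  -- a.s. every open pair lies inside `S`
  have hae : ∀ᵐ ω ∂prodBernoulli w, ∀ e ∈ ω, ∀ x ∈ e, x ∈ Sset := by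
    have hZ : ({e : Sym2 V | ∃ x ∈ e, x ∉ S}).Countable := Set.to_countable _
    filter_upwards [prodBernoulli_ae_forall_notMem w hZ fun e he => hw e he] with ω hω e he x hx
    by_contra hxS
    exact hω e ⟨x, hx, hxS⟩ he
  -- transport of connection probabilities
  have key : ∀ (x y : V) (hx : x ∈ Sset) (hy : y ∈ Sset),
      (prodBernoulli w').real (openConn (⟨x, hx⟩ : Sset) ⟨y, hy⟩) = (prodBernoulli w).real (openConn x y) := by
    intro x y hx hy
    rw [hw', ← hmap, map_measureReal_apply (measurable_restrictConfig _) (measurableSet_openConn_holds _ _)]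
    refine measureReal_congr ?_
    filter_upwards [hae] with ω hω
    refine propext ⟨fun h' => ?_, fun h' => ?_⟩
    · exact reachable_map_of_restrictConfig hfi ω h'
    · exact reachable_restrictConfig_subtype_of_reachable hω hx hy h'
  set A' : Finset Sset := A.subtype (· ∈ Sset) with hA'
  have keyU : (prodBernoulli w').real (⋃ a ∈ A', openConn (⟨o, ho⟩ : Sset) a) =
      (prodBernoulli w).real (⋃ a ∈ A, openConn o a) := by
    rw [hw', ← hmap, map_measureReal_apply (measurable_restrictConfig _)
      (Finset.measurableSet_biUnion _ fun a _ => measurableSet_openConn_holds _ _)]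
    refine measureReal_congr ?_
    filter_upwards [hae] with ω hω
    change (ω ∈ restrictConfig f ⁻¹' (⋃ a ∈ A', openConn (⟨o, ho⟩ : Sset) a)) =
      (ω ∈ ⋃ a ∈ A, openConn o a)
    simp only [Set.mem_preimage, Set.mem_iUnion, exists_prop, hA', Finset.mem_subtype, eq_iff_iff]
    constructor
    · rintro ⟨a, ha, h'⟩
      exact ⟨a, ha, reachable_map_of_restrictConfig hfi ω h'⟩
    · rintro ⟨a, ha, h'⟩
      exact ⟨⟨a, hAS ha⟩, ha, reachable_restrictConfig_subtype_of_reachable hω ho (hAS ha) h'⟩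
  have h1 := additiveGluing_fintype w' A' (⟨o, ho⟩ : Sset) ⟨b, hb⟩ ht (by
    intro a ha
    rw [hA', Finset.mem_subtype] at ha
    have := hab a ha
    rwa [← key a b a.2 hb] at this)
  rwa [key, keyU] at h1

/-- **Additive gluing with a target SET and region-internal relay reliability** (the form Step V of
Kozma–Nitzan's Lemma 10 consumes, KN p. 22: "we identified the set `T` to a point and used that point as the
`b`"): for finitely supported weights on a countable vertex type, a nonempty finite target set `T ⊆ S`, relays
`A ⊆ S` each joined to `T` INSIDE a region `Rg` with probability `≥ 1 − t`, and an observer `o ∈ S`,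
`P(o ↔ A) − t ≤ P(o ↔ T)`.  Proof: `additiveGluing_finSupp` for the wired weights `wireW T w` and any `t₀ ∈ T`
(`prodBernoulli_wireW_real_openConn`), monotonicity of `{o ↔ A}` under wiring, and `{a ↔ x in Rg} ⊆ {a ↔ x}`.
builds on p205010 (kernel theorem, internal audit signed; external expert review pending).
[cite: KozmaNitzan2024, §4 p. 22 and Conjecture 3 (p. 15)] -/
theorem additiveGluing_finSupp_set {V : Type*} [Countable V] (w : Sym2 V → unitInterval) (S : Finset V)
    (hw : ∀ e : Sym2 V, (∃ x ∈ e, x ∉ S) → w e = 0) (A T : Finset V) (o : V) (Rg : Set V)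
    (hAS : A ⊆ S) (hTS : T ⊆ S) (ho : o ∈ S) (hT : T.Nonempty) {t : ℝ} (ht : 0 ≤ t)
    (haT : ∀ a ∈ A, 1 - t ≤ (prodBernoulli w).real (⋃ x ∈ T, openConnIn Rg a x)) :
    (prodBernoulli w).real (⋃ a ∈ A, openConn o a) - t ≤ (prodBernoulli w).real (⋃ x ∈ T, openConn o x) := by
  obtain ⟨t₀, ht₀⟩ := hT
  have hw' : ∀ e : Sym2 V, (∃ x ∈ e, x ∉ S) → wireW (↑T : Set V) w e = 0 := by
    intro e he
    rw [wireW_apply_of_not_mem w ?_, hw e he]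
    obtain ⟨x, hx, hxS⟩ := he
    exact fun h' => hxS (hTS (h'.1 x hx))
  -- relays are reliable to `t₀` in the wired graph
  have hab : ∀ a ∈ A, 1 - t ≤ (prodBernoulli (wireW (↑T : Set V) w)).real (openConn a t₀) := by
    intro a ha
    rw [prodBernoulli_wireW_real_openConn w (↑T : Set V) (Finset.mem_coe.2 ht₀) a]
    refine (haT a ha).trans (measureReal_mono (Set.iUnion₂_mono fun x _ ω hω => ?_) (measure_ne_top _ _))
    rw [DCT16.mem_openConnIn_iff_pathIn] at hω
    exact reachable_of_pathIn hω
  have h1 := additiveGluing_finSupp (wireW (↑T : Set V) w) S hw' A o t₀ hAS ho (hTS ht₀) ht hab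
  rw [prodBernoulli_wireW_real_openConn w (↑T : Set V) (Finset.mem_coe.2 ht₀) o] at h1
  have hmono := prodBernoulli_real_biUnion_openConn_mono (le_wireW (↑T : Set V) w) o (↑A : Set V)
  have e1 : (⋃ a ∈ (↑A : Set V), openConn o a : Set (BondConfig V)) = ⋃ a ∈ A, openConn o a := by
    ext ω; simp only [Set.mem_iUnion, Finset.mem_coe]
  have e2 : (⋃ x ∈ (↑T : Set V), openConn o x : Set (BondConfig V)) = ⋃ x ∈ T, openConn o x := by
    ext ω; simp only [Set.mem_iUnion, Finset.mem_coe]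
  rw [e1] at hmono
  rw [e2] at h1
  linarith

end Summit.CriticalPhenomena.PercolationContinuityZ3.Theorems.Quant

end
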